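import Summits.QuantumFields.YangMills.Theorems.UnitScaleTiltProp7HermiteCornerBlendEnergy
import Summits.QuantumFields.YangMills.Theorems.UnitScaleTiltProp7HermiteCardinalWeightsColumns
import HarnessLib

/-!
# Route `UnitScaleTilt`, crux K1 «MinimiserStabilityRegPr» (stmt-QuantumFields-19200), route-R E′ path (α′), row LEMMA-H-CURVED — FILE 5a (torus dictionary of the weights):
# THE CORNER-BLEND ENERGY ON THE FINE TORUS WITH THE C¹ CARDINAL WEIGHTS — ALL WEIGHT ROWS DISCHARGED, FRAME AND DATA ROWS DISPLAYED

Cell `ym3-torus`, D-0154 (3c) twin-width seat `ym-routeR-w1` (gen 5); row "routeR-w1 g5: LEMMA-H-CURVED" (namer ★ym-ust-19200-p1 g14, 2026-08-28 17:33Z; design of record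
(x2′-corner), contract v2 18:49Z).  THEOREMS ONLY (0 `def`, 0 `sorry`); `--supports stmt-QuantumFields-19200`, count-neutral.  YM₃ on T³ is a ladder rung (R3), not the
Clay problem; nothing here claims a stub, the crux, d = 4 or the mass gap.

WHAT.  ✓ `Prop7HermiteCornerBlendEnergy.sum_sq_norm_lap_cornerBlend_le` instantiated on the fine torus `Site P 0` (shifts `torusT P 0`, any bi-contractive background `U`
with values in a real normed algebra `𝔸`), centres `Site P k`, and the C¹ CARDINAL WEIGHTS `W_y(x) = Π_ν E_ν(x, y_ν)` of ✓ `Prop7HermiteCardinalWeights` (offset `h`,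
profile `p` with displayed rows): the five weight rows are DISCHARGED (`G₁ = 6∕ℓ`, `G₂ = 24∕ℓ²` by ✓ `…Mass`; `K₀ = ℓ^d`, `K₁ = (6∕ℓ)ℓ^d`, `K₂ = (24∕ℓ²)ℓ^d` by ✓ `…Columns`),
the support predicate is the explicit `N y z :⇔ ∀ ν, y_ν − Q_ν(z) ∈ {−1, 0, 1, 2}` (Sect. 1 proves the weights vanish off it at `z` and `z ± e_μ`), and the blend INTERPOLATES
(`Φ(embIter y) = m_y` for frames normalised at their centre, offset `h = (ℓ−1)∕2`).  What stays displayed: the frame rows `a₀`, `a₁` on `N` (supplied from (3.35) cube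
gauges by routeR-w4's `Prop7ConjFrameReg335`) and the data row `G_y`.

HOW.  Sect. 1: block labels move by at most one under a unit step (`blockLabel_shift`, `blockLabel_unshift`, via the centre-line lemmas of ✓ `Prop7HermiteOffsets` and
`Q(x) = Q(x⌊μ⌋)`), hence `weights_vanish_of_far`; Sect. 2: the weight rows in the letters of the abstract theorem; Sect. 3: ★★★ `sum_sq_norm_lap_cornerBlend_torus_le`; Sect. 4: ★
`cornerBlend_embIter` (interpolation at the centres).
HONEST SCOPE.  Bookkeeping; the frame rows and the data row are hypotheses; nothing of Bałaban's is asserted.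

References: T. Bałaban, CMP 99 (1985) 389–434 [Balaban1985BackgroundPropagators] ((3.3)-(3.4) pp.390-391, (3.35) p.396); CMP 95 (1984) 17–40 [Balaban1984PropagatorsI]
((1.18) p.20, (1.29)-(1.31) p.23).
-/

set_option autoImplicit false

noncomputable section

open scoped BigOperators

namespace Summit.QuantumFields.YangMills.Theorems.Prop7HermiteCornerBlendTorus

open Literature.MathematicalPhysics.QuantumFieldTheory.Balaban1983to89
open Finset
open B9Eq39Adjoint (R R_one covD divB)
open B9TorusCalculus (torusT torusT_apply torusT_symm_apply)
open Summit.QuantumFields.YangMills.Theorems.Prop7TentInterpolation (shift_eq_update)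
open Summit.QuantumFields.YangMills.Theorems.Prop7HermiteOffsets (corner_shift_of_lt corner_shift_of_eq corner_unshift_of_pos corner_unshift_of_zero)
open Summit.QuantumFields.YangMills.Theorems.Prop7HermiteInterpolation (runConst_blockInput)
open Summit.QuantumFields.YangMills.Theorems.Prop7HermiteCardinalWeights (iterBlockOf_apply_update_ne iterBlockOf_apply_longShift sum_weight_eq_one weight_nonneg
  weight_embIter)
open Summit.QuantumFields.YangMills.Theorems.Prop7HermiteCardinalWeightsMass (weightE_eq_zero_of_ne sum_abs_diff_weight_le sum_abs_secondDiff_weight_le)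
open Summit.QuantumFields.YangMills.Theorems.Prop7HermiteCardinalWeightsColumns (iterBlockOf_apply_longUnshift sum_weight_col sum_abs_diff_weight_col_le
  sum_abs_secondDiff_weight_col_le)
open Summit.QuantumFields.YangMills.Theorems.Prop7HermiteCornerBlendEnergy (sum_sq_norm_lap_cornerBlend_le)
open B5Eq118OneStroke (iterBlockOf)
open B15DeterminingSets (embIter)

variable {P : Params} {k : ℕ} (hk : k ≤ P.m + P.K) (h : ZMod (P.sitesPerDir 0)) (p : ℕ → ℝ)

/-! ## §1 Block labels under a unit step; the support of the weights -/

section Support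

include hk

omit p in
/-- the block label is constant along a run: `Q(x) = Q(x⌊μ⌋)`. [cite: Balaban1984PropagatorsI, (1.18) p.20] -/
theorem blockLabel_corner (μ ν : Fin P.d) (x : Site P 0) : (iterBlockOf k (fun κ => x κ - h)) ν = (iterBlockOf k (fun κ => (Function.update x μ (x μ - ((((x μ - h).val % P.L ^ k : ℕ)) : ZMod (P.sitesPerDir 0)))) κ - h)) ν := by
  have e := runConst_blockInput h hk (fun q : Site P k => ((q ν).val : ℝ)) μ x
  simp only [] at e
  exact ZMod.val_injective _ (by exact_mod_cast e)

omit p in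
/-- in the other coordinates a unit step does not move the block label: `Q_ν(x ± e_μ) = Q_ν(x)` (`ν ≠ μ`). [cite: Balaban1984PropagatorsI, (1.18) p.20] -/
theorem blockLabel_shift_ne {μ ν : Fin P.d} (hμν : μ ≠ ν) (x : Site P 0) :
    (iterBlockOf k (fun κ => (x.shift μ) κ - h)) ν = (iterBlockOf k (fun κ => x κ - h)) ν ∧ (iterBlockOf k (fun κ => (x.unshift μ) κ - h)) ν = (iterBlockOf k (fun κ => x κ - h)) ν :=
  ⟨iterBlockOf_apply_update_ne hk h hμν x _, iterBlockOf_apply_update_ne hk h hμν x _⟩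

omit p in
/-- ★ under a unit step the block label moves by at most one: `Q_μ(x + e_μ) ∈ {Q_μ(x), Q_μ(x) + 1}`. [cite: Balaban1984PropagatorsI, (1.18) p.20] -/
theorem blockLabel_shift_self (μ : Fin P.d) (x : Site P 0) :
    (iterBlockOf k (fun κ => (x.shift μ) κ - h)) μ = (iterBlockOf k (fun κ => x κ - h)) μ ∨ (iterBlockOf k (fun κ => (x.shift μ) κ - h)) μ = (iterBlockOf k (fun κ => x κ - h)) μ + 1 := by
  have hℓN : P.L ^ k ∣ P.sitesPerDir 0 := ⟨P.sitesPerDir k, by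
    unfold Params.sitesPerDir; rw [Nat.sub_zero, mul_left_comm, ← pow_add, Nat.add_sub_cancel' hk]⟩
  have hℓ : 0 < P.L ^ k := pow_pos P.L_pos k
  have hr : (x μ - h).val % P.L ^ k + 1 ≤ P.L ^ k := Nat.mod_lt _ hℓ
  rw [blockLabel_corner hk h μ μ (x.shift μ), blockLabel_corner hk h μ μ x]
  rcases Nat.lt_or_eq_of_le hr with hlt | heq
  · left
    rw [corner_shift_of_lt (P.L ^ k) h hℓN x μ hlt]
  · right
    rw [corner_shift_of_eq (P.L ^ k) h hℓN x μ heq]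
    have hx : Function.update x μ (x μ - ((((x μ - h).val % P.L ^ k : ℕ)) : ZMod (P.sitesPerDir 0)) + ((P.L ^ k : ℕ) : ZMod (P.sitesPerDir 0)))
        = Function.update (Function.update x μ (x μ - ((((x μ - h).val % P.L ^ k : ℕ)) : ZMod (P.sitesPerDir 0)))) μ ((Function.update x μ (x μ - ((((x μ - h).val % P.L ^ k : ℕ)) : ZMod (P.sitesPerDir 0)))) μ + ((P.L ^ k : ℕ) : ZMod (P.sitesPerDir 0))) := by
      rw [Function.update_self, Function.update_idem]
    rw [hx, iterBlockOf_apply_longShift hk h (Function.update x μ (x μ - ((((x μ - h).val % P.L ^ k : ℕ)) : ZMod (P.sitesPerDir 0)))) μ]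
    simp only [Site.shift, Function.update_self]

omit p in
/-- ★ `Q_μ(x − e_μ) ∈ {Q_μ(x), Q_μ(x) − 1}`. [cite: Balaban1984PropagatorsI, (1.18) p.20] -/
theorem blockLabel_unshift_self (μ : Fin P.d) (x : Site P 0) :
    (iterBlockOf k (fun κ => (x.unshift μ) κ - h)) μ = (iterBlockOf k (fun κ => x κ - h)) μ ∨ (iterBlockOf k (fun κ => (x.unshift μ) κ - h)) μ = (iterBlockOf k (fun κ => x κ - h)) μ - 1 := by
  have hℓN : P.L ^ k ∣ P.sitesPerDir 0 := ⟨P.sitesPerDir k, by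
    unfold Params.sitesPerDir; rw [Nat.sub_zero, mul_left_comm, ← pow_add, Nat.add_sub_cancel' hk]⟩
  have hℓ : 0 < P.L ^ k := pow_pos P.L_pos k
  rw [blockLabel_corner hk h μ μ (x.unshift μ), blockLabel_corner hk h μ μ x]
  rcases Nat.eq_zero_or_pos ((x μ - h).val % P.L ^ k) with h0 | hpos
  · right
    rw [corner_unshift_of_zero (P.L ^ k) h hℓN hℓ x μ h0]
    have hx : Function.update x μ (x μ - ((((x μ - h).val % P.L ^ k : ℕ)) : ZMod (P.sitesPerDir 0)) - ((P.L ^ k : ℕ) : ZMod (P.sitesPerDir 0)))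
        = Function.update (Function.update x μ (x μ - ((((x μ - h).val % P.L ^ k : ℕ)) : ZMod (P.sitesPerDir 0)))) μ ((Function.update x μ (x μ - ((((x μ - h).val % P.L ^ k : ℕ)) : ZMod (P.sitesPerDir 0)))) μ - ((P.L ^ k : ℕ) : ZMod (P.sitesPerDir 0))) := by
      rw [Function.update_self, Function.update_idem]
    rw [hx]
    exact iterBlockOf_apply_longUnshift hk h (Function.update x μ (x μ - ((((x μ - h).val % P.L ^ k : ℕ)) : ZMod (P.sitesPerDir 0)))) μ
  · left
    rw [corner_unshift_of_pos (P.L ^ k) h hℓN hℓ x μ hpos]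

/-- the factor `E_ν(x, t)` vanishes unless `t ∈ {Q_ν(x), Q_ν(x)+1}`; contrapositive bookkeeping for a centre coordinate `t = y_ν` outside `{Q_ν − 1, Q_ν, Q_ν + 1, Q_ν + 2}` at the
three points `x`, `x ± e_μ`. [cite: Balaban1984PropagatorsI, (1.29)-(1.31) p.23] -/
theorem weights_vanish_of_far (y : Site P k) (z : Site P 0)
    (hfar : ¬ ∀ ν : Fin P.d, (y ν = (iterBlockOf k (fun κ => z κ - h)) ν - 1 ∨ y ν = (iterBlockOf k (fun κ => z κ - h)) ν ∨ y ν = (iterBlockOf k (fun κ => z κ - h)) ν + 1 ∨ y ν = (iterBlockOf k (fun κ => z κ - h)) ν + 2)) :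
    (∏ ν : Fin P.d, (p ((z ν - h).val % P.L ^ k) * (if (iterBlockOf k (fun κ => z κ - h)) ν = y ν then (1 : ℝ) else 0) + (1 - p ((z ν - h).val % P.L ^ k)) * (if (iterBlockOf k (fun κ => z κ - h)) ν + 1 = y ν then (1 : ℝ) else 0))) = 0 ∧ (∀ μ : Fin P.d, (∏ ν : Fin P.d, (p (((torusT P 0 μ z) ν - h).val % P.L ^ k) * (if (iterBlockOf k (fun κ => (torusT P 0 μ z) κ - h)) ν = y ν then (1 : ℝ) else 0) + (1 - p (((torusT P 0 μ z) ν - h).val % P.L ^ k)) * (if (iterBlockOf k (fun κ => (torusT P 0 μ z) κ - h)) ν + 1 = y ν then (1 : ℝ) else 0))) = 0) ∧ (∀ μ : Fin P.d, (∏ ν : Fin P.d, (p ((((torusT P 0 μ).symm z) ν - h).val % P.L ^ k) * (if (iterBlockOf k (fun κ => ((torusT P 0 μ).symm z) κ - h)) ν = y ν then (1 : ℝ) else 0) + (1 - p ((((torusT P 0 μ).symm z) ν - h).val % P.L ^ k)) * (if (iterBlockOf k (fun κ => ((torusT P 0 μ).symm z) κ - h)) ν + 1 = y ν then (1 : ℝ)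 else 0))) = 0) := by
  obtain ⟨ν, hν⟩ := not_forall.mp hfar
  have h1 : y ν ≠ (iterBlockOf k (fun κ => z κ - h)) ν - 1 := fun e => hν (Or.inl e)
  have h2 : y ν ≠ (iterBlockOf k (fun κ => z κ - h)) ν := fun e => hν (Or.inr (Or.inl e))
  have h3 : y ν ≠ (iterBlockOf k (fun κ => z κ - h)) ν + 1 := fun e => hν (Or.inr (Or.inr (Or.inl e)))
  have h4 : y ν ≠ (iterBlockOf k (fun κ => z κ - h)) ν + 2 := fun e => hν (Or.inr (Or.inr (Or.inr e)))
  refine ⟨?_, fun μ => ?_, fun μ => ?_⟩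
  · exact Finset.prod_eq_zero (Finset.mem_univ ν) (weightE_eq_zero_of_ne h p ν (y ν) z (fun e => h2 e.symm) (fun e => h3 e.symm))
  · rw [torusT_apply]
    refine Finset.prod_eq_zero (Finset.mem_univ ν) (weightE_eq_zero_of_ne h p ν (y ν) (z.shift μ) ?_ ?_)
    · by_cases hμν : μ = ν
      · subst hμν
        rcases blockLabel_shift_self hk h μ z with e | e <;> rw [e]
        · exact fun e' => h2 e'.symm
        · exact fun e' => h3 e'.symm
      · rw [(blockLabel_shift_ne hk h hμν z).1]; exact fun e' => h2 e'.symm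
    · by_cases hμν : μ = ν
      · subst hμν
        rcases blockLabel_shift_self hk h μ z with e | e <;> rw [e]
        · exact fun e' => h3 e'.symm
        · rw [add_assoc, one_add_one_eq_two]; exact fun e' => h4 e'.symm
      · rw [(blockLabel_shift_ne hk h hμν z).1]; exact fun e' => h3 e'.symm
  · rw [torusT_symm_apply]
    refine Finset.prod_eq_zero (Finset.mem_univ ν) (weightE_eq_zero_of_ne h p ν (y ν) (z.unshift μ) ?_ ?_)
    · by_cases hμν : μ = ν
      · subst hμν
        rcases blockLabel_unshift_self hk h μ z with e | e <;> rw [e]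
        · exact fun e' => h2 e'.symm
        · exact fun e' => h1 e'.symm
      · rw [(blockLabel_shift_ne hk h hμν z).2]; exact fun e' => h2 e'.symm
    · by_cases hμν : μ = ν
      · subst hμν
        rcases blockLabel_unshift_self hk h μ z with e | e <;> rw [e]
        · exact fun e' => h3 e'.symm
        · rw [sub_add_cancel]; exact fun e' => h2 e'.symm
      · rw [(blockLabel_shift_ne hk h hμν z).2]; exact fun e' => h3 e'.symm

end Support

/-! ## §2 The weight rows in the letters of the abstract energy theorem -/

section Rows

include hk

/-- `y`-mass of the gradient (✓ `…Mass.sum_abs_diff_weight_le`) in `torusT` letters. [cite: Balaban1984PropagatorsI, (1.29)-(1.31) p.23] -/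
theorem mass_grad_row (hp0 : p 0 = 1) (hpℓ : p (P.L ^ k) = 0) (hp01 : ∀ r : ℕ, r < P.L ^ k → 0 ≤ p r ∧ p r ≤ 1)
    (hpS : ∀ r : ℕ, r + 1 ≤ P.L ^ k → |p (r + 1) - p r| ≤ 3 / (((P.L ^ k : ℕ) : ℝ))) (z : Site P 0) (μ : Fin P.d) :
    ∑ y : Site P k, |(∏ ν : Fin P.d, (p (((torusT P 0 μ z) ν - h).val % P.L ^ k) * (if (iterBlockOf k (fun κ => (torusT P 0 μ z) κ - h)) ν = y ν then (1 : ℝ) else 0) + (1 - p (((torusT P 0 μ z) ν - h).val % P.L ^ k)) * (if (iterBlockOf k (fun κ => (torusT P 0 μ z) κ - h)) ν + 1 = y ν then (1 : ℝ) else 0))) - (∏ ν : Fin P.d, (p ((z ν - h).val % P.L ^ k) * (if (iterBlockOf k (fun κ => z κ - h)) ν = y ν then (1 : ℝ) else 0) + (1 - p ((z ν - h).val % P.L ^ k)) * (if (iterBlockOf k (fun κ => z κ - h)) ν + 1 = y ν then (1 : ℝ) else 0)))| ≤ 6 / (((P.L ^ k : ℕ) : ℝ)) := by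
  rw [torusT_apply]; exact sum_abs_diff_weight_le hk h p hp0 hpℓ hp01 hpS μ z

/-- `y`-mass of the second difference (✓ `…Mass.sum_abs_secondDiff_weight_le`) in `torusT` letters. [cite: Balaban1984PropagatorsI, (1.29)-(1.31) p.23] -/
theorem mass_second_row (hp0 : p 0 = 1) (hpℓ : p (P.L ^ k) = 0) (hp01 : ∀ r : ℕ, r < P.L ^ k → 0 ≤ p r ∧ p r ≤ 1)
    (hpD : ∀ r : ℕ, 1 ≤ r → r + 1 ≤ P.L ^ k → |p (r + 1) - 2 * p r + p (r - 1)| ≤ 6 / (((P.L ^ k : ℕ) : ℝ)) ^ 2)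
    (hpc : p 1 + p (P.L ^ k - 1) = 1) (hpk : p (P.L ^ k - 1) ≤ 3 / (((P.L ^ k : ℕ) : ℝ)) ^ 2) (z : Site P 0) (μ : Fin P.d) :
    ∑ y : Site P k, |((∏ ν : Fin P.d, (p (((torusT P 0 μ z) ν - h).val % P.L ^ k) * (if (iterBlockOf k (fun κ => (torusT P 0 μ z) κ - h)) ν = y ν then (1 : ℝ) else 0) + (1 - p (((torusT P 0 μ z) ν - h).val % P.L ^ k)) * (if (iterBlockOf k (fun κ => (torusT P 0 μ z) κ - h)) ν + 1 = y ν then (1 : ℝ) else 0))) - (∏ ν : Fin P.d, (p ((z ν - h).val % P.L ^ k) * (if (iterBlockOf k (fun κ => z κ - h)) ν = y ν then (1 : ℝ) else 0) + (1 - p ((z ν - h).val % P.L ^ k)) * (if (iterBlockOf k (fun κ => z κ - h)) ν + 1 = y ν then (1 : ℝ) else 0)))) - ((∏ ν : Fin P.d, (p ((z ν - h).val % P.L ^ k) * (if (iterBlockOf k (fun κ => z κ - h)) ν = y ν then (1 : ℝ) else 0) + (1 - p ((z ν - h).val % P.L ^ k)) * (if (iterBlockOf k (fun κ => z κ - h))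 ν + 1 = y ν then (1 : ℝ) else 0))) - (∏ ν : Fin P.d, (p ((((torusT P 0 μ).symm z) ν - h).val % P.L ^ k) * (if (iterBlockOf k (fun κ => ((torusT P 0 μ).symm z) κ - h)) ν = y ν then (1 : ℝ) else 0) + (1 - p ((((torusT P 0 μ).symm z) ν - h).val % P.L ^ k)) * (if (iterBlockOf k (fun κ => ((torusT P 0 μ).symm z) κ - h)) ν + 1 = y ν then (1 : ℝ) else 0))))| ≤ 24 / (((P.L ^ k : ℕ) : ℝ)) ^ 2 := by
  have e : ∀ a b c : ℝ, |(a - b) - (b - c)| = |a - 2 * b + c| := fun a b c => by congr 1; ring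
  rw [torusT_apply, torusT_symm_apply]
  simp only [e]
  exact sum_abs_secondDiff_weight_le hk h p hp0 hpℓ hp01 hpD hpc hpk μ z

/-- column mass (✓ `…Columns.sum_weight_col`). [cite: Balaban1984PropagatorsI, (1.18) p.20] -/
theorem col_zero_row (y : Site P k) : ∑ z : Site P 0, (∏ ν : Fin P.d, (p ((z ν - h).val % P.L ^ k) * (if (iterBlockOf k (fun κ => z κ - h)) ν = y ν then (1 : ℝ) else 0) + (1 - p ((z ν - h).val % P.L ^ k)) * (if (iterBlockOf k (fun κ => z κ - h)) ν + 1 = y ν then (1 : ℝ) else 0))) ≤ (((P.L ^ k : ℕ) : ℝ)) ^ P.d := (sum_weight_col hk h p y).le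

/-- column mass of the gradient (✓ `…Columns.sum_abs_diff_weight_col_le`) in `torusT` letters. [cite: Balaban1984PropagatorsI, (1.18) p.20, (1.29)-(1.31) p.23] -/
theorem col_grad_row (hp0 : p 0 = 1) (hpℓ : p (P.L ^ k) = 0) (hp01 : ∀ r : ℕ, r < P.L ^ k → 0 ≤ p r ∧ p r ≤ 1)
    (hpS : ∀ r : ℕ, r + 1 ≤ P.L ^ k → |p (r + 1) - p r| ≤ 3 / (((P.L ^ k : ℕ) : ℝ))) (y : Site P k) (μ : Fin P.d) :
    ∑ z : Site P 0, |(∏ ν : Fin P.d, (p (((torusT P 0 μ z) ν - h).val % P.L ^ k) * (if (iterBlockOf k (fun κ => (torusT P 0 μ z) κ - h)) ν = y ν then (1 : ℝ) else 0) + (1 - p (((torusT P 0 μ z) ν - h).val % P.L ^ k)) * (if (iterBlockOf k (fun κ => (torusT P 0 μ z) κ - h)) ν + 1 = y ν then (1 : ℝ) else 0))) - (∏ ν : Fin P.d, (p ((z ν - h).val % P.L ^ k) * (if (iterBlockOf k (fun κ => z κ - h)) ν = y ν then (1 : ℝ) else 0) + (1 - p ((z ν - h).val % P.L ^ k)) *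 (if (iterBlockOf k (fun κ => z κ - h)) ν + 1 = y ν then (1 : ℝ) else 0)))| ≤ 6 / (((P.L ^ k : ℕ) : ℝ)) * (((P.L ^ k : ℕ) : ℝ)) ^ P.d := by
  simp only [torusT_apply]; exact sum_abs_diff_weight_col_le hk h p hp0 hpℓ hpS hp01 y μ

/-- column mass of the second difference (✓ `…Columns.sum_abs_secondDiff_weight_col_le`) in `torusT` letters. [cite: Balaban1984PropagatorsI, (1.18) p.20, (1.29)-(1.31) p.23] -/
theorem col_second_row (hp0 : p 0 = 1) (hpℓ : p (P.L ^ k) = 0) (hp01 : ∀ r : ℕ, r < P.L ^ k → 0 ≤ p r ∧ p r ≤ 1)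
    (hpD : ∀ r : ℕ, 1 ≤ r → r + 1 ≤ P.L ^ k → |p (r + 1) - 2 * p r + p (r - 1)| ≤ 6 / (((P.L ^ k : ℕ) : ℝ)) ^ 2)
    (hpc : p 1 + p (P.L ^ k - 1) = 1) (hpk : p (P.L ^ k - 1) ≤ 3 / (((P.L ^ k : ℕ) : ℝ)) ^ 2) (y : Site P k) (μ : Fin P.d) :
    ∑ z : Site P 0, |((∏ ν : Fin P.d, (p (((torusT P 0 μ z) ν - h).val % P.L ^ k) * (if (iterBlockOf k (fun κ => (torusT P 0 μ z) κ - h)) ν = y ν then (1 : ℝ) else 0) + (1 - p (((torusT P 0 μ z) ν - h).val % P.L ^ k)) * (if (iterBlockOf k (fun κ => (torusT P 0 μ z) κ - h)) ν + 1 = y ν then (1 : ℝ) else 0))) - (∏ ν : Fin P.d, (p ((z ν - h).val % P.L ^ k) * (if (iterBlockOf k (fun κ => z κ - h)) ν = y ν then (1 : ℝ) else 0) + (1 - p ((z ν - h).val % P.L ^ k)) * (if (iterBlockOf k (fun κ => z κ - h)) ν + 1 = y ν then (1 : ℝ) else 0)))) - ((∏ ν : Fin P.d, (p ((z ν - h).val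 % P.L ^ k) * (if (iterBlockOf k (fun κ => z κ - h)) ν = y ν then (1 : ℝ) else 0) + (1 - p ((z ν - h).val % P.L ^ k)) * (if (iterBlockOf k (fun κ => z κ - h)) ν + 1 = y ν then (1 : ℝ) else 0))) - (∏ ν : Fin P.d, (p ((((torusT P 0 μ).symm z) ν - h).val % P.L ^ k) * (if (iterBlockOf k (fun κ => ((torusT P 0 μ).symm z) κ - h)) ν = y ν then (1 : ℝ) else 0) + (1 - p ((((torusT P 0 μ).symm z) ν - h).val % P.L ^ k)) * (if (iterBlockOf k (fun κ => ((torusT P 0 μ).symm z) κ - h)) ν + 1 = y ν then (1 : ℝ) else 0))))| ≤ 24 / (((P.L ^ k : ℕ) : ℝ)) ^ 2 * (((P.L ^ k : ℕ) : ℝ)) ^ P.d := by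
  have hpk0 : 0 ≤ p (P.L ^ k - 1) := (hp01 _ (Nat.sub_lt (pow_pos P.L_pos k) Nat.one_pos)).1
  have e : ∀ a b c : ℝ, |(a - b) - (b - c)| = |a - 2 * b + c| := fun a b c => by congr 1; ring
  simp only [torusT_apply, torusT_symm_apply, e]
  exact sum_abs_secondDiff_weight_col_le hk h p hp0 hpℓ hpD hpc hpk0 hpk hp01 y μ

end Rows

/-! ## §3 The energy of the corner blend on the fine torus -/

section Energy

variable {𝔸 : Type} [NormedRing 𝔸] [NormedAlgebra ℝ 𝔸]

include hk

/-- ★★★ **THE CORNER-BLEND ENERGY ON THE FINE TORUS** (weights discharged; frame rows `a₀`, `a₁` and data row `G` displayed on the support predicate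
`∀ ν, y_ν − Q_ν(z) ∈ {−1,0,1,2}`): `Σ_z ‖Δ_UΦ(z)‖² ≤ [3(2d(a₁+2a₀²))²ℓ^d + 48d²a₀²(6∕ℓ)((6∕ℓ)ℓ^d)]·Σ_y‖m_y − c_y‖² + 3d²(24∕ℓ²)((24∕ℓ²)ℓ^d)·Σ_y G_y²`.
[cite: Balaban1985BackgroundPropagators, (3.3)-(3.4) pp.390-391, (3.35) p.396; Balaban1984PropagatorsI, (1.29)-(1.31) p.23] -/
theorem sum_sq_norm_lap_cornerBlend_torus_le (hp0 : p 0 = 1) (hpℓ : p (P.L ^ k) = 0) (hp01 : ∀ r : ℕ, r < P.L ^ k → 0 ≤ p r ∧ p r ≤ 1)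
    (hpS : ∀ r : ℕ, r + 1 ≤ P.L ^ k → |p (r + 1) - p r| ≤ 3 / (((P.L ^ k : ℕ) : ℝ)))
    (hpD : ∀ r : ℕ, 1 ≤ r → r + 1 ≤ P.L ^ k → |p (r + 1) - 2 * p r + p (r - 1)| ≤ 6 / (((P.L ^ k : ℕ) : ℝ)) ^ 2)
    (hpc : p 1 + p (P.L ^ k - 1) = 1) (hpk : p (P.L ^ k - 1) ≤ 3 / (((P.L ^ k : ℕ) : ℝ)) ^ 2)
    (U : Fin P.d → Site P 0 → 𝔸ˣ) (hU : ∀ (κ : Fin P.d) (z : Site P 0), ‖(U κ z : 𝔸)‖ ≤ 1 ∧ ‖(((U κ z)⁻¹ : 𝔸ˣ) : 𝔸)‖ ≤ 1)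
    (Fr : Site P k → Site P 0 → 𝔸ˣ) (hFr : ∀ y z, ‖(Fr y z : 𝔸)‖ ≤ 1 ∧ ‖(((Fr y z)⁻¹ : 𝔸ˣ) : 𝔸)‖ ≤ 1)
    (m c : Site P k → 𝔸) (hc : ∀ y (a : 𝔸), Commute (c y) a) (a₀ a₁ : ℝ)
    (hA : ∀ (y : Site P k) (z : Site P 0), (∀ ν : Fin P.d, (y ν = (iterBlockOf k (fun κ => z κ - h)) ν - 1 ∨ y ν = (iterBlockOf k (fun κ => z κ - h)) ν ∨ y ν = (iterBlockOf k (fun κ => z κ - h)) ν + 1 ∨ y ν = (iterBlockOf k (fun κ => z κ - h)) ν + 2)) → ∀ μ : Fin P.d,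
      ‖(((Fr y z)⁻¹ * U μ z * Fr y (torusT P 0 μ z) : 𝔸ˣ) : 𝔸) - 1‖ ≤ a₀
      ∧ ‖(((Fr y ((torusT P 0 μ).symm z))⁻¹ * U μ ((torusT P 0 μ).symm z) * Fr y z : 𝔸ˣ) : 𝔸) - 1‖ ≤ a₀
      ∧ ‖(((Fr y z)⁻¹ * U μ z * Fr y (torusT P 0 μ z) : 𝔸ˣ) : 𝔸)
          - (((Fr y ((torusT P 0 μ).symm z))⁻¹ * U μ ((torusT P 0 μ).symm z) * Fr y z : 𝔸ˣ) : 𝔸)‖ ≤ a₁)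
    (Z : Fin P.d → Site P 0 → 𝔸) (G : Site P k → ℝ)
    (hG : ∀ (y : Site P k) (z : Site P 0), (∀ ν : Fin P.d, (y ν = (iterBlockOf k (fun κ => z κ - h)) ν - 1 ∨ y ν = (iterBlockOf k (fun κ => z κ - h)) ν ∨ y ν = (iterBlockOf k (fun κ => z κ - h)) ν + 1 ∨ y ν = (iterBlockOf k (fun κ => z κ - h)) ν + 2)) → ∀ μ : Fin P.d,
      ‖R (Fr y z) (m y) - Z μ z‖ ≤ G y) :
    ∑ z : Site P 0, ‖divB (torusT P 0) U (fun μ => covD (torusT P 0) U μ (fun z' => ∑ y : Site P k, (∏ ν : Fin P.d, (p ((z' ν - h).val % P.L ^ k) * (if (iterBlockOf k (fun κ => z' κ - h)) ν = y ν then (1 : ℝ) else 0) + (1 - p ((z' ν - h).val % P.L ^ k)) * (if (iterBlockOf k (fun κ => z' κ - h)) ν + 1 = y ν then (1 : ℝ) else 0))) • R (Fr y z') (m y))) z‖ ^ 2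
      ≤ (3 * (2 * (P.d : ℝ) * (a₁ + 2 * a₀ ^ 2)) ^ 2 * (((P.L ^ k : ℕ) : ℝ)) ^ P.d
          + 48 * (P.d : ℝ) ^ 2 * a₀ ^ 2 * (6 / (((P.L ^ k : ℕ) : ℝ))) * (6 / (((P.L ^ k : ℕ) : ℝ)) * (((P.L ^ k : ℕ) : ℝ)) ^ P.d)) * ∑ y : Site P k, ‖m y - c y‖ ^ 2
        + 3 * (P.d : ℝ) ^ 2 * (24 / (((P.L ^ k : ℕ) : ℝ)) ^ 2) * (24 / (((P.L ^ k : ℕ) : ℝ)) ^ 2 * (((P.L ^ k : ℕ) : ℝ)) ^ P.d) * ∑ y : Site P k, G y ^ 2 := by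
  have hW1 : ∀ z : Site P 0, ∑ y : Site P k, (∏ ν : Fin P.d, (p ((z ν - h).val % P.L ^ k) * (if (iterBlockOf k (fun κ => z κ - h)) ν = y ν then (1 : ℝ) else 0) + (1 - p ((z ν - h).val % P.L ^ k)) * (if (iterBlockOf k (fun κ => z κ - h)) ν + 1 = y ν then (1 : ℝ) else 0))) = 1 := fun z => sum_weight_eq_one h p z
  have hW0 : ∀ (y : Site P k) (z : Site P 0), 0 ≤ (∏ ν : Fin P.d, (p ((z ν - h).val % P.L ^ k) * (if (iterBlockOf k (fun κ => z κ - h)) ν = y ν then (1 : ℝ) else 0) + (1 - p ((z ν - h).val % P.L ^ k)) * (if (iterBlockOf k (fun κ => z κ - h)) ν + 1 = y ν then (1 : ℝ) else 0))) := fun y z => weight_nonneg h p hp01 y z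
  have hN : ∀ (y : Site P k) (z : Site P 0), ¬ (∀ ν : Fin P.d, (y ν = (iterBlockOf k (fun κ => z κ - h)) ν - 1 ∨ y ν = (iterBlockOf k (fun κ => z κ - h)) ν ∨ y ν = (iterBlockOf k (fun κ => z κ - h)) ν + 1 ∨ y ν = (iterBlockOf k (fun κ => z κ - h)) ν + 2)) →
      (∏ ν : Fin P.d, (p ((z ν - h).val % P.L ^ k) * (if (iterBlockOf k (fun κ => z κ - h)) ν = y ν then (1 : ℝ) else 0) + (1 - p ((z ν - h).val % P.L ^ k)) * (if (iterBlockOf k (fun κ => z κ - h)) ν + 1 = y ν then (1 : ℝ) else 0))) = 0 ∧ (∀ μ : Fin P.d, (∏ ν : Fin P.d, (p (((torusT P 0 μ z) ν - h).val % P.L ^ k) * (if (iterBlockOf k (fun κ => (torusT P 0 μ z) κ - h)) ν = y ν then (1 : ℝ) else 0) + (1 - p (((torusT P 0 μ z) ν - h).val % P.L ^ k)) * (if (iterBlockOf k (fun κ => (torusT P 0 μ z) κ - h)) ν + 1 = y ν then (1 : ℝ) else 0))) = 0) ∧ (∀ μ : Fin P.d, (∏ ν : Fin P.d, (p ((((torusT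 P 0 μ).symm z) ν - h).val % P.L ^ k) * (if (iterBlockOf k (fun κ => ((torusT P 0 μ).symm z) κ - h)) ν = y ν then (1 : ℝ) else 0) + (1 - p ((((torusT P 0 μ).symm z) ν - h).val % P.L ^ k)) * (if (iterBlockOf k (fun κ => ((torusT P 0 μ).symm z) κ - h)) ν + 1 = y ν then (1 : ℝ) else 0))) = 0) := fun y z hfar => weights_vanish_of_far hk h p y z hfar
  have hM1 := mass_grad_row hk h p hp0 hpℓ hp01 hpS
  have hM2 := mass_second_row hk h p hp0 hpℓ hp01 hpD hpc hpk
  have hK0 := col_zero_row hk h p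
  have hK1 := col_grad_row hk h p hp0 hpℓ hp01 hpS
  have hK2 := col_second_row hk h p hp0 hpℓ hp01 hpD hpc hpk
  have hG₁ : (0 : ℝ) ≤ 6 / (((P.L ^ k : ℕ) : ℝ)) := by positivity
  have hG₂ : (0 : ℝ) ≤ 24 / (((P.L ^ k : ℕ) : ℝ)) ^ 2 := by positivity
  have hmain := sum_sq_norm_lap_cornerBlend_le (Y := Site P k) (torusT P 0) U hU (fun y z => (∏ ν : Fin P.d, (p ((z ν - h).val % P.L ^ k) * (if (iterBlockOf k (fun κ => z κ - h)) ν = y ν then (1 : ℝ) else 0) + (1 - p ((z ν - h).val % P.L ^ k)) * (if (iterBlockOf k (fun κ => z κ - h)) ν + 1 = y ν then (1 : ℝ) else 0)))) hW1 hW0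
    Fr hFr m c hc (fun y z => ∀ ν : Fin P.d, (y ν = (iterBlockOf k (fun κ => z κ - h)) ν - 1 ∨ y ν = (iterBlockOf k (fun κ => z κ - h)) ν ∨ y ν = (iterBlockOf k (fun κ => z κ - h)) ν + 1 ∨ y ν = (iterBlockOf k (fun κ => z κ - h)) ν + 2))
    hN a₀ a₁ hA Z G hG _ _ _ _ _ hG₁ hG₂ hM1 hM2 hK0 hK1 hK2
  rw [Fintype.card_fin] at hmain
  exact hmain

end Energy

/-! ## §4 Interpolation at the centres (offset `h = (ℓ−1)∕2`, frames normalised at their centre) -/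

section Centre

variable {𝔸 : Type} [NormedRing 𝔸] [NormedAlgebra ℝ 𝔸]

include hk

omit h in
/-- ★ **THE BLEND INTERPOLATES**: `Φ(embIter y) = m_y` when `P_y(embIter y) = 1` (cardinal weights: `W_(y′)(embIter y) = δ_(y y′)`, ✓ `weight_embIter`). [cite: Balaban1984PropagatorsI, (1.29)-(1.31) p.23] -/
theorem cornerBlend_embIter (hp0 : p 0 = 1) (Fr : Site P k → Site P 0 → 𝔸ˣ) (m : Site P k → 𝔸) (y : Site P k) (hFr1 : Fr y (embIter k y) = 1) :
    ∑ y' : Site P k, (∏ ν : Fin P.d, (p (((embIter k y) ν - ((((P.L ^ k - 1) / 2 : ℕ)) : ZMod (P.sitesPerDir 0))).val % P.L ^ k) * (if (iterBlockOf k (fun κ => (embIter k y) κ - ((((P.L ^ k - 1) / 2 : ℕ)) : ZMod (P.sitesPerDir 0)))) ν = y' ν then (1 : ℝ) else 0) + (1 - p (((embIter k y) ν - ((((P.L ^ k - 1) / 2 : ℕ)) : ZMod (P.sitesPerDir 0))).val % P.L ^ k)) * (if (iterBlockOf k (fun κ => (embIter k y) κ - ((((P.L ^ k - 1) / 2 :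 ℕ)) : ZMod (P.sitesPerDir 0)))) ν + 1 = y' ν then (1 : ℝ) else 0))) • R (Fr y' (embIter k y)) (m y') = m y := by
  have hw : ∀ y' : Site P k, (∏ ν : Fin P.d, (p (((embIter k y) ν - ((((P.L ^ k - 1) / 2 : ℕ)) : ZMod (P.sitesPerDir 0))).val % P.L ^ k) * (if (iterBlockOf k (fun κ => (embIter k y) κ - ((((P.L ^ k - 1) / 2 : ℕ)) : ZMod (P.sitesPerDir 0)))) ν = y' ν then (1 : ℝ) else 0) + (1 - p (((embIter k y) ν - ((((P.L ^ k - 1) / 2 : ℕ)) : ZMod (P.sitesPerDir 0))).val % P.L ^ k)) * (if (iterBlockOf k (fun κ => (embIter k y) κ - ((((P.L ^ k - 1) / 2 : ℕ)) : ZMod (P.sitesPerDir 0)))) ν + 1 = y' ν then (1 : ℝ) else 0))) = if y = y' then (1 : ℝ) else 0 := fun y' => weight_embIter hk p hp0 y' y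
  simp only [hw, ite_smul, one_smul, zero_smul, Finset.sum_ite_eq, Finset.mem_univ, if_true]
  rw [hFr1, R_one]

omit h in
/-- ★★★ **THE EXTENSION ROW FOR LEMMA-H-CURVED**: an extension `Φ` of the centre data `m` with the displayed Laplacian energy exists (the corner blend at offset
`h = (ℓ−1)∕2`), given bi-contractive frames normalised at their centres with rows `a₀`, `a₁` near the centre and the data row `G`.
[cite: Balaban1985BackgroundPropagators, (3.3)-(3.4) pp.390-391, (3.35) p.396; Balaban1984PropagatorsI, (1.29)-(1.31) p.23] -/
theorem exists_extension_lap_energy_le (hp0 : p 0 = 1) (hpℓ : p (P.L ^ k) = 0) (hp01 : ∀ r : ℕ, r < P.L ^ k → 0 ≤ p r ∧ p r ≤ 1)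
    (hpS : ∀ r : ℕ, r + 1 ≤ P.L ^ k → |p (r + 1) - p r| ≤ 3 / (((P.L ^ k : ℕ) : ℝ)))
    (hpD : ∀ r : ℕ, 1 ≤ r → r + 1 ≤ P.L ^ k → |p (r + 1) - 2 * p r + p (r - 1)| ≤ 6 / (((P.L ^ k : ℕ) : ℝ)) ^ 2)
    (hpc : p 1 + p (P.L ^ k - 1) = 1) (hpk : p (P.L ^ k - 1) ≤ 3 / (((P.L ^ k : ℕ) : ℝ)) ^ 2)
    (U : Fin P.d → Site P 0 → 𝔸ˣ) (hU : ∀ (κ : Fin P.d) (z : Site P 0), ‖(U κ z : 𝔸)‖ ≤ 1 ∧ ‖(((U κ z)⁻¹ : 𝔸ˣ) : 𝔸)‖ ≤ 1)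
    (Fr : Site P k → Site P 0 → 𝔸ˣ) (hFr : ∀ y z, ‖(Fr y z : 𝔸)‖ ≤ 1 ∧ ‖(((Fr y z)⁻¹ : 𝔸ˣ) : 𝔸)‖ ≤ 1) (hFr1 : ∀ y, Fr y (embIter k y) = 1)
    (m c : Site P k → 𝔸) (hc : ∀ y (a : 𝔸), Commute (c y) a) (a₀ a₁ : ℝ)
    (hA : ∀ (y : Site P k) (z : Site P 0), (∀ ν : Fin P.d, (y ν = (iterBlockOf k (fun κ => z κ - ((((P.L ^ k - 1) / 2 : ℕ)) : ZMod (P.sitesPerDir 0)))) ν - 1 ∨ y ν = (iterBlockOf k (fun κ => z κ - ((((P.L ^ k - 1) / 2 : ℕ)) : ZMod (P.sitesPerDir 0)))) ν ∨ y ν = (iterBlockOf k (fun κ => z κ - ((((P.L ^ k - 1) / 2 : ℕ)) : ZMod (P.sitesPerDir 0)))) ν + 1 ∨ y ν = (iterBlockOf k (fun κ => z κ - ((((P.L ^ k - 1) / 2 : ℕ)) : ZMod (P.sitesPerDir 0)))) ν + 2)) → ∀ μ : Fin P.d,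
      ‖(((Fr y z)⁻¹ * U μ z * Fr y (torusT P 0 μ z) : 𝔸ˣ) : 𝔸) - 1‖ ≤ a₀
      ∧ ‖(((Fr y ((torusT P 0 μ).symm z))⁻¹ * U μ ((torusT P 0 μ).symm z) * Fr y z : 𝔸ˣ) : 𝔸) - 1‖ ≤ a₀
      ∧ ‖(((Fr y z)⁻¹ * U μ z * Fr y (torusT P 0 μ z) : 𝔸ˣ) : 𝔸)
          - (((Fr y ((torusT P 0 μ).symm z))⁻¹ * U μ ((torusT P 0 μ).symm z) * Fr y z : 𝔸ˣ) : 𝔸)‖ ≤ a₁)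
    (Z : Fin P.d → Site P 0 → 𝔸) (G : Site P k → ℝ)
    (hG : ∀ (y : Site P k) (z : Site P 0), (∀ ν : Fin P.d, (y ν = (iterBlockOf k (fun κ => z κ - ((((P.L ^ k - 1) / 2 : ℕ)) : ZMod (P.sitesPerDir 0)))) ν - 1 ∨ y ν = (iterBlockOf k (fun κ => z κ - ((((P.L ^ k - 1) / 2 : ℕ)) : ZMod (P.sitesPerDir 0)))) ν ∨ y ν = (iterBlockOf k (fun κ => z κ - ((((P.L ^ k - 1) / 2 : ℕ)) : ZMod (P.sitesPerDir 0)))) ν + 1 ∨ y ν = (iterBlockOf k (fun κ => z κ - ((((P.L ^ k - 1) / 2 : ℕ)) : ZMod (P.sitesPerDir 0)))) ν + 2)) → ∀ μ : Fin P.d,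
      ‖R (Fr y z) (m y) - Z μ z‖ ≤ G y) :
    ∃ Φ : Site P 0 → 𝔸, (∀ y : Site P k, Φ (embIter k y) = m y) ∧
      ∑ z : Site P 0, ‖divB (torusT P 0) U (fun μ => covD (torusT P 0) U μ Φ) z‖ ^ 2
        ≤ (3 * (2 * (P.d : ℝ) * (a₁ + 2 * a₀ ^ 2)) ^ 2 * (((P.L ^ k : ℕ) : ℝ)) ^ P.d
            + 48 * (P.d : ℝ) ^ 2 * a₀ ^ 2 * (6 / (((P.L ^ k : ℕ) : ℝ))) * (6 / (((P.L ^ k : ℕ) : ℝ)) * (((P.L ^ k : ℕ) : ℝ)) ^ P.d)) * ∑ y : Site P k, ‖m y - c y‖ ^ 2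
          + 3 * (P.d : ℝ) ^ 2 * (24 / (((P.L ^ k : ℕ) : ℝ)) ^ 2) * (24 / (((P.L ^ k : ℕ) : ℝ)) ^ 2 * (((P.L ^ k : ℕ) : ℝ)) ^ P.d) * ∑ y : Site P k, G y ^ 2 :=
  ⟨fun z' => ∑ y : Site P k, (∏ ν : Fin P.d, (p ((z' ν - ((((P.L ^ k - 1) / 2 : ℕ)) : ZMod (P.sitesPerDir 0))).val % P.L ^ k) * (if (iterBlockOf k (fun κ => z' κ - ((((P.L ^ k - 1) / 2 : ℕ)) : ZMod (P.sitesPerDir 0)))) ν = y ν then (1 : ℝ) else 0) + (1 - p ((z' ν - ((((P.L ^ k - 1) / 2 : ℕ)) : ZMod (P.sitesPerDir 0))).val % P.L ^ k)) * (if (iterBlockOf k (fun κ => z' κ - ((((P.L ^ k - 1) / 2 : ℕ)) : ZMod (P.sitesPerDir 0)))) ν + 1 = y ν then (1 : ℝ) else 0))) • R (Fr y z') (m y), fun y => cornerBlend_embIter hk p hp0 Fr m y (hFr1 y),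
    sum_sq_norm_lap_cornerBlend_torus_le hk ((((P.L ^ k - 1) / 2 : ℕ)) : ZMod (P.sitesPerDir 0)) p hp0 hpℓ hp01 hpS hpD hpc hpk U hU Fr hFr m c hc a₀ a₁ hA Z G hG⟩

end Centre

end Summit.QuantumFields.YangMills.Theorems.Prop7HermiteCornerBlendTorus

end
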